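import Literature.GroupTheory.ArithmeticGroups.SL2PrimePowSchurMultiplierOdd
import Literature.GroupTheory.CentralExtensionExponentLift
import HarnessLib

/-!
# The `p`-part of the Schur multiplier of `SL₂(ℤ/p^e)`, `p` odd: kernels of `p`-power exponent

`SL2SchurMultiplierOdd.eq_one_of_mem_ker_of_mem_commutator_odd` says: for `p` an odd prime and every `e`, a
central extension `π : E ↠ SL₂(ℤ/p^e)` whose kernel has exponent `p` satisfies `ker π ∩ [E, E] = 1`.  By the
exponent-lifting lemma for central extensions (`CentralExtensionExponentLift.eq_one_of_forall_exponent`,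
Hopf's formula argument) the same holds for kernels of exponent `p^a` — in particular for `p = 3`, where
`SL₂(ℤ/3^e)` is solvable and the perfectness shortcut of `SL2SchurMultiplierPGroup` is not available.  This is
the full `p`-primary part of Beyl's theorem `M(SL₂(ℤ/p^e)) = 0` (`p` odd) for `p`-group kernels of bounded
exponent. [Beyl1986]
-/

open scoped MatrixGroups

universe u

namespace Literature.GroupTheory.ArithmeticGroups

namespace SL2SchurMultiplierOddPGroup

/-- **Beyl's theorem, `p`-part, `p` odd, kernels of exponent `p^a`.**  For an odd prime `p`, any `e a : ℕ` and
any central extension `π : E ↠ SL₂(ℤ/p^e)` whose kernel has exponent dividing `p^a`: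
`ker π ∩ [E, E] = 1`. [cite: Beyl1986, Theorem (M(SL(2,ℤ/m)) = 0 for 4 ∤ m), p-primary part] -/
theorem eq_one_of_mem_ker_of_mem_commutator_odd_pgroup (p : ℕ) [Fact p.Prime] (hp2 : p ≠ 2) (e a : ℕ)
    {E : Type u} [Group E] (π : E →* SL(2, ZMod (p ^ e))) (hsurj : Function.Surjective π)
    (hcen : ∀ z : E, π z = 1 → ∀ g : E, g * z = z * g) (hexp : ∀ z : E, π z = 1 → z ^ (p ^ a) = 1)
    {z : E} (hz : π z = 1) (hzc : z ∈ commutator E) : z = 1 :=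
  CentralExtensionExponentLift.eq_one_of_forall_exponent (Fact.out : p.Prime).ne_zero
    (fun _ _ π' hs hc he _ hz' hzc' ↦
      SL2SchurMultiplierOdd.eq_one_of_mem_ker_of_mem_commutator_odd p hp2 e π' hs hc he hz' hzc')
    π hsurj hcen a hexp hz hzc

end SL2SchurMultiplierOddPGroup

end Literature.GroupTheory.ArithmeticGroups
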